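import Literature.Geometry.ComplexAnalytic.PhamBrieskornCyclicNodeSphereTransversal
import Literature.Geometry.ComplexAnalytic.CyclicNodePencilMorseChart
import HarnessLib

/-!
# The pencil function and the Morse radius are jointly submersive on the shells (chart form)

Family `hodge`, layer `Literature/Geometry/ComplexAnalytic`; sequel of `CyclicNodePencilMorseChart` (the explicit holomorphic Morse
chart `Θ` at the node of `φ(x) = x₂^p − (x₀x₁ + x₀^p + x₁^p)`, with `Σ (Θ x)ᵢ^{eᵢ} = φ(x)`, `e = (2, 2, p)`) and of
`PhamBrieskornCyclicNodeSphereTransversal` (`surjective_fderiv_cyclicNodeLevelRadius_of_shell`: in the MODEL coordinates `z` the map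
`z ↦ (Σ zᵢ^{eᵢ}, Σ |zᵢ|²)` has onto real differential on the shells `r₀² ≤ Σ|zᵢ|² ≤ r₂²` over the disc `|Σ zᵢ^{eᵢ}| < r₀^p`).
Here the statement is transported to the PENCIL coordinates `x`: with the Morse radius `r(x) = Σᵢ |(Θ x)ᵢ|²`,

* `hasFDerivAt_equiv_of_contDiffOn_symm` — a `C¹` open partial homeomorphism with `C¹` inverse has INVERTIBLE differential at the
  points of its source (chain rule for `Θ⁻¹ ∘ Θ = id`, `Θ ∘ Θ⁻¹ = id`);
* `surjective_fderiv_pencil_morseRadius_of_shell` — **`x ↦ (φ(x), r(x))` has onto real differential at every `x ∈ Θ.source` with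
  `r₀² ≤ r(x) ≤ r₂²` and `|φ(x)| < r₀^p`** (`0 < r₀ ≤ r₂ < 1`, `r₂^{p−2} < 2/p`, `p ≥ 3`): `(φ, r) = (P, ρ) ∘ Θ` near `x` and `DΘ(x)` is
  invertible.

This is the Euclidean input `hsurj₂` of the tangent-lift lemma `Geometry/Manifold/SubmersionLiftVectorField`
(`exists_contMDiff_lift_vectorField_tangent`) for the degeneration `x₃^p = f₁ + c·x₂^p` to the one-nodal curve `f₁ = 0` read in the
affine chart `x₂ = 1` of the regular locus of the universal surface (programme discharging
`HodgeTheory/CyclicCoverNodalMeridianLocalMonodromyBound`): the lifted translation fields can be chosen tangent to the Morse shells.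
Everything is proved; no definitions, no named facts.

## References

* [Milnor1968] J. Milnor, Singular Points of Complex Hypersurfaces (1968), §4 (Curve Selection Lemma) and Lemma 5.9–5.10 (the spheres
  `S_ε` are transverse to the fibres near an isolated critical point).
* [ArnoldGuseinzadeVarchenko2012] V. I. Arnold, S. M. Gusein-Zade, A. N. Varchenko, Singularities of Differentiable Maps II (2012),
  Part I §1.1–§2.1 (the Milnor fibration in a ball; non-degenerate critical points, Morse lemma).
-/

noncomputable section

open Complex ComplexConjugate Set Filter Topology
open scoped BigOperators ContDiff

namespace Literature.Geometry.ComplexAnalytic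

namespace PhamBrieskorn

/-! ### Invertible differential of a `C¹` partial homeomorphism with `C¹` inverse -/

/-- **A `C^∞` open partial homeomorphism with `C^∞` inverse has invertible differential** at the points of its source: there is a
continuous linear equivalence `L` with `HasFDerivAt Θ L x` (chain rule applied to `Θ⁻¹ ∘ Θ = id` near `x` and `Θ ∘ Θ⁻¹ = id` near
`Θ x`). [cite: ArnoldGuseinzadeVarchenko2012, Part I §1.1] -/
theorem hasFDerivAt_equiv_of_contDiffOn_symm {E : Type*} [NormedAddCommGroup E] [NormedSpace ℝ E] [CompleteSpace E]
    (Θ : OpenPartialHomeomorph E E) (hΘ : ContDiffOn ℝ ∞ Θ Θ.source) (hΘs : ContDiffOn ℝ ∞ Θ.symm Θ.target)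
    {x : E} (hx : x ∈ Θ.source) :
    ∃ L : E ≃L[ℝ] E, HasFDerivAt Θ (L : E →L[ℝ] E) x := by
  have hd : HasFDerivAt Θ (fderiv ℝ Θ x) x :=
    ((hΘ.differentiableOn (by simp)).differentiableAt (Θ.open_source.mem_nhds hx)).hasFDerivAt
  have hy : Θ x ∈ Θ.target := Θ.map_source hx
  have hds : HasFDerivAt Θ.symm (fderiv ℝ Θ.symm (Θ x)) (Θ x) :=
    ((hΘs.differentiableOn (by simp)).differentiableAt (Θ.open_target.mem_nhds hy)).hasFDerivAt
  -- `Θ⁻¹ ∘ Θ = id` near `x`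
  have h1 : (fderiv ℝ Θ.symm (Θ x)).comp (fderiv ℝ Θ x) = ContinuousLinearMap.id ℝ E := by
    have hc : HasFDerivAt (Θ.symm ∘ Θ) ((fderiv ℝ Θ.symm (Θ x)).comp (fderiv ℝ Θ x)) x := hds.comp x hd
    have hid : HasFDerivAt (Θ.symm ∘ Θ) (ContinuousLinearMap.id ℝ E) x := by
      refine (hasFDerivAt_id x).congr_of_eventuallyEq ?_
      filter_upwards [Θ.open_source.mem_nhds hx] with x' hx'
      exact Θ.left_inv hx'
    exact hc.unique hid
  -- `Θ ∘ Θ⁻¹ = id` near `Θ x`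
  have h2 : (fderiv ℝ Θ x).comp (fderiv ℝ Θ.symm (Θ x)) = ContinuousLinearMap.id ℝ E := by
    have hd' : HasFDerivAt Θ (fderiv ℝ Θ x) (Θ.symm (Θ x)) := by rw [Θ.left_inv hx]; exact hd
    have hc : HasFDerivAt (Θ ∘ Θ.symm) ((fderiv ℝ Θ x).comp (fderiv ℝ Θ.symm (Θ x))) (Θ x) := hd'.comp (Θ x) hds
    have hid : HasFDerivAt (Θ ∘ Θ.symm) (ContinuousLinearMap.id ℝ E) (Θ x) := by
      refine (hasFDerivAt_id (Θ x)).congr_of_eventuallyEq ?_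
      filter_upwards [Θ.open_target.mem_nhds hy] with y' hy'
      exact Θ.right_inv hy'
    exact hc.unique hid
  have hl : Function.LeftInverse (fderiv ℝ Θ.symm (Θ x)) (fderiv ℝ Θ x) := fun v =>
    congrArg (fun f : E →L[ℝ] E => f v) h1
  have hr : Function.RightInverse (fderiv ℝ Θ.symm (Θ x)) (fderiv ℝ Θ x) := fun v =>
    congrArg (fun f : E →L[ℝ] E => f v) h2
  refine ⟨ContinuousLinearEquiv.equivOfInverse (fderiv ℝ Θ x) (fderiv ℝ Θ.symm (Θ x)) hl hr, ?_⟩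
  have hcoe : ((ContinuousLinearEquiv.equivOfInverse (fderiv ℝ Θ x) (fderiv ℝ Θ.symm (Θ x)) hl hr :
      E ≃L[ℝ] E) : E →L[ℝ] E) = fderiv ℝ Θ x := by
    ext v
    exact ContinuousLinearEquiv.equivOfInverse_apply _ _ hl hr v
  rw [hcoe]
  exact hd

/-! ### The pencil function and the Morse radius -/

variable (p : ℕ)

/-- **Joint submersion of `(φ, r)` on the shells, in the pencil coordinates.** Let `Θ` be a `C^∞` open partial homeomorphism of `ℂ³`
with `C^∞` inverse and `Σᵢ (Θ x)ᵢ^{eᵢ} = φ(x)` on its source (`e = cyclicNodeExponents p = (2,2,p)`; e.g. the Morse chart of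
`exists_cyclicNodePencil_morseChart`). For `0 < r₀ ≤ r₂ < 1`, `r₂^{p−2} < 2/p`, `p ≥ 3`, at every `x ∈ Θ.source` with
`r₀² ≤ Σᵢ |(Θ x)ᵢ|² ≤ r₂²` and `|φ(x)| < r₀^p`, the real differential of `x ↦ (φ(x), Σᵢ |(Θ x)ᵢ|²)` is onto.
[cite: Milnor1968, Lemma 5.10] [cite: ArnoldGuseinzadeVarchenko2012, Part I §2.1] -/
theorem surjective_fderiv_pencil_morseRadius_of_shell (hp : 3 ≤ p)
    (Θ : OpenPartialHomeomorph (Fin (1 + 2) → ℂ) (Fin (1 + 2) → ℂ))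
    (hΘ : ContDiffOn ℝ ∞ Θ Θ.source) (hΘs : ContDiffOn ℝ ∞ Θ.symm Θ.target)
    (φ : (Fin (1 + 2) → ℂ) → ℂ) (hΘφ : ∀ x ∈ Θ.source, ∑ i, (Θ x) i ^ cyclicNodeExponents p i = φ x)
    {r₀ r₂ : ℝ} (hr₀ : 0 < r₀) (hr₀₂ : r₀ ≤ r₂) (hr₂ : r₂ < 1) (hr₂' : r₂ ^ (p - 2) < 2 / p)
    {x : Fin (1 + 2) → ℂ} (hx : x ∈ Θ.source)
    (hlow : r₀ ^ 2 ≤ ∑ i, ‖Θ x i‖ ^ 2) (hup : ∑ i, ‖Θ x i‖ ^ 2 ≤ r₂ ^ 2) (hφ : ‖φ x‖ < r₀ ^ p) :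
    Function.Surjective (fderiv ℝ (fun x : Fin (1 + 2) → ℂ => ((φ x : ℂ), (∑ i, ‖Θ x i‖ ^ 2 : ℝ))) x) := by
  haveI : CompleteSpace (Fin (1 + 2) → ℂ) := inferInstance
  -- the model map and its derivative at `z = Θ x`
  set G : (Fin (1 + 2) → ℂ) → ℂ × ℝ :=
    fun z => ((∑ i, z i ^ cyclicNodeExponents p i : ℂ), (∑ i, ‖z i‖ ^ 2 : ℝ)) with hG
  obtain ⟨LG, hLG, -⟩ := hasFDerivAt_cyclicNodeLevelRadius p (Θ x)
  have hP : ‖∑ i, Θ x i ^ cyclicNodeExponents p i‖ < r₀ ^ p := by rw [hΘφ x hx]; exact hφ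
  have hsurjG : Function.Surjective (fderiv ℝ G (Θ x)) :=
    surjective_fderiv_cyclicNodeLevelRadius_of_shell p hp hr₀ hr₀₂ hr₂ hr₂' hlow hup hP
  rw [hLG.fderiv] at hsurjG
  -- the chart derivative
  obtain ⟨L, hL⟩ := hasFDerivAt_equiv_of_contDiffOn_symm Θ hΘ hΘs hx
  -- `(φ, r) = G ∘ Θ` near `x`
  have hcomp : HasFDerivAt (fun x : Fin (1 + 2) → ℂ => ((φ x : ℂ), (∑ i, ‖Θ x i‖ ^ 2 : ℝ)))
      (LG.comp (L : (Fin (1 + 2) → ℂ) →L[ℝ] (Fin (1 + 2) → ℂ))) x := by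
    refine (hLG.comp x hL).congr_of_eventuallyEq ?_
    filter_upwards [Θ.open_source.mem_nhds hx] with x' hx'
    simp only [Function.comp_apply, hΘφ x' hx']
  rw [hcomp.fderiv, ContinuousLinearMap.coe_comp]
  exact hsurjG.comp L.surjective

/-- **The shell submersion for the Morse chart of the pencil** `x₃^p = x₀x₁ + x₀^p + x₁^p + c` (existence form): for `p ≥ 3` there is
an open partial homeomorphism `Θ` of `ℂ³` at `0` — the chart of `exists_cyclicNodePencil_morseChart` — such that for all radii
`0 < r₀ ≤ r₂ < 1` with `r₂^{p−2} < 2/p` the map `x ↦ (φ(x), Σᵢ |(Θ x)ᵢ|²)`, `φ(x) = x₂^p − (x₀x₁ + x₀^p + x₁^p)`, has onto differential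
at the points of the shell region `{x ∈ Θ.source | r₀² ≤ Σ|(Θ x)ᵢ|² ≤ r₂², |φ x| < r₀^p}`.
[cite: Milnor1968, Lemma 5.10] [cite: ArnoldGuseinzadeVarchenko2012, Part I §2.1] -/
theorem exists_morseChart_shell_submersion (hp : 3 ≤ p) :
    ∃ Θ : OpenPartialHomeomorph (Fin (1 + 2) → ℂ) (Fin (1 + 2) → ℂ),
      (0 : Fin (1 + 2) → ℂ) ∈ Θ.source ∧ Θ 0 = 0 ∧
      DifferentiableOn ℂ Θ Θ.source ∧ ContDiffOn ℝ ∞ Θ Θ.source ∧ ContDiffOn ℝ ∞ Θ.symm Θ.target ∧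
      (∀ x ∈ Θ.source, ∑ i, (Θ x) i ^ cyclicNodeExponents p i = x 2 ^ p - (x 0 * x 1 + x 0 ^ p + x 1 ^ p)) ∧
      (∀ x ∈ Θ.source, (Θ x) 2 = x 2) ∧
      ∀ {r₀ r₂ : ℝ}, 0 < r₀ → r₀ ≤ r₂ → r₂ < 1 → r₂ ^ (p - 2) < 2 / p →
        ∀ {x : Fin (1 + 2) → ℂ}, x ∈ Θ.source → r₀ ^ 2 ≤ ∑ i, ‖Θ x i‖ ^ 2 → ∑ i, ‖Θ x i‖ ^ 2 ≤ r₂ ^ 2 →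
          ‖x 2 ^ p - (x 0 * x 1 + x 0 ^ p + x 1 ^ p)‖ < r₀ ^ p →
          Function.Surjective (fderiv ℝ (fun x : Fin (1 + 2) → ℂ =>
            ((x 2 ^ p - (x 0 * x 1 + x 0 ^ p + x 1 ^ p) : ℂ), (∑ i, ‖Θ x i‖ ^ 2 : ℝ))) x) := by
  obtain ⟨Θ, h0, hΘ0, hhol, hΘ, hΘs, hΘφ, hΘ2⟩ := exists_cyclicNodePencil_morseChart hp
  exact ⟨Θ, h0, hΘ0, hhol, hΘ, hΘs, hΘφ, hΘ2, fun hr₀ hr₀₂ hr₂ hr₂' _ hx hlow hup hφ =>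
    surjective_fderiv_pencil_morseRadius_of_shell p hp Θ hΘ hΘs
      (fun x => x 2 ^ p - (x 0 * x 1 + x 0 ^ p + x 1 ^ p)) hΘφ hr₀ hr₀₂ hr₂ hr₂' hx hlow hup hφ⟩

end PhamBrieskorn

end Literature.Geometry.ComplexAnalytic

end
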